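import Summits.BirchSwinnertonDyer.Rank1Residual.AdditivePotMult.EigenLeadingTermInput
import Summits.BirchSwinnertonDyer.Rank1Residual.Additive.ChiBranchInputBigImage
import Summits.BirchSwinnertonDyer.Rank1Residual.Additive.ChiBranchConstantTermOdd
import Summits.BirchSwinnertonDyer.Rank1Residual.Additive.XSplitMultRankZeroCyclotomicThreeFacts
import Literature.NumberTheory.EllipticCurves.Wuthrich2014.ReducibleDivisibilityCyclotomicThreeMinus
import Literature.NumberTheory.EllipticCurves.Wuthrich2014.SurjectiveDivisibilityCyclotomicThreeMinus
import Literature.NumberTheory.EllipticCurves.LeadingTermPPartProofs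
import Literature.NumberTheory.EllipticCurves.SelmerPInftyRelModelAction
import Literature.NumberTheory.GaloisRepresentations.CubicReciprocityRationalPrime
import Mathlib.NumberTheory.Cyclotomic.PrimitiveRoots
import HarnessLib

/-!
# [B∘C]@0 at `p = 3` IS A THEOREM: `ChiBranchLeadingTermOdd[BigImage]At W 3` for EVERY `W/ℚ`
# from the componentwise Wuthrich / Kato readings over `ℚ(ζ_{3^∞})` and the kernel transport [C]
# — kernel brick 5 (cell `b2b-bsdres`, seat additive-p1, gen 9)

HONEST FRAMING (cell `b2b-bsdres`, run/shared/lean/b2b/bsd-rank1-residual/, verbatim in every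
file): the goal of the cell is to DELETE the COMBINATION-SHAPED residual classes of the
Birch–Swinnerton-Dyer formula for ALL analytic-rank `≤ 1` elliptic curves over `ℚ` — "full BSD
formula for every rank `≤ 1` curve in class `C`" assembled STRICTLY from published theorems — so
that the rank-`≤ 1` remainder becomes exactly the CONSTRUCTION-SHAPED classes, which are TYPED
(missing-input `Prop`s), NOT attempted. This is not "finishing BSD". The additive sub-cell (seats
additive-p1…p4) is a RESEARCH ROUTE on the construction-shaped classes X3/X4; sub-cell additive-p1
= the potentially MULTIPLICATIVE additive prime (X3♯(M) / X4(M)); no claim beyond the stated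
classes; the labels of X3/X4 are UNCHANGED by this file; nothing is booked.

Theorems, one conversion `def` (`ChiEigenSelmerDualData.toEigen`, a field-for-field repackaging
with the SAME carrier) and one typed predicate (`EigenLeadingTermOddBigImageAt`, the big-image twin
of gen 8's `EigenLeadingTermOddAt`; nothing asserted). Context: design
HOME/b2b-bsdres-additive-p1/KERNEL-C-P3.md. Since gen 2 of additive-p4 the rank-`0` upper half
`ord_p #Ш(E) ≤ ord_p #Ш_an(E)` on the additive classes at `p ≡ 3 (mod 4)` rests on ONE typed input
per image type, `ChiBranchLeadingTermOddAt W p` (reducible) / `ChiBranchLeadingTermOddBigImageAt W p`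
(big image) = [B∘C] at `T = 0`. Gen 8 put the transport [C] in the kernel (`TwistDescent`,
`ChiEigenSelmerDual`, `GeneratorNormalisation`, `EigenLeadingTermInput`:
`ChiBranchLeadingTermOddAt W p ⇐ ∀ V, EigenLeadingTermOddAt V K p`). Gen 9 filed [B] at `p = 3` as
two componentwise READING-FACTS in the Literature eigen-Selmer vocabulary
(`Wuthrich2014.thm16_minusEigenCharIdeal_dvd_cyclotomicThree`, p233088 — Thm. 16, `ω`-component,
semistable `3`, `E[3]` reducible; `Wuthrich2014.kato_minusEigenCharIdeal_dvd_cyclotomicThree_of_surjective`,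
p233255 — Kato 17.4 (3) / Thm. 3–Cor. 19 attribution, `ω`-component, `ρ_{E,3^∞}` onto). THIS FILE
assembles:

* §1 `chiEigenSelmer_eq_eigenSelmerGroupOver` (`rfl`) and `ChiEigenSelmerDualData.toEigen` — the
  cell's `χ_K`-eigen dual datum IS a Literature `EigenSelmerDualData` at
  `(H, H', ε) = (ker κ ⊓ Gal(ℚ̄/K), ker κ, χ_K)`, same module, same `charIdeal`;
* §2 `exists_oddBranch_three` — the odd branch `L⁻` of a `3`-semistable `V` in the facts'
  disjunctive shape with `L⁻(0) = e · ∑(a/3)[a/3]⁻_f`, `e ∈ ℤ₃ˣ` (tree theorems: MTT §I.13–I.14 for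
  the two-term and one-term minus measures);
* §3 **`eigenLeadingTermOddAt_three_of_fact`: `EigenLeadingTermOddAt V K 3` for every `V` and every
  `K = ℚ(ζ₃)`**, from p233088; §4 the big-image twin (`EigenLeadingTermOddBigImageAt`,
  `chiBranchLeadingTermOddBigImageAt_of_eigenLeadingTermBigImage` — gen 8's reduction without the
  reducibility transfer —, `eigenLeadingTermOddBigImageAt_three_of_fact` from p233255);
* §5–§6 `√−3 = 2ζ₃ + 1` (`[ℚ(ζ₃):ℚ] = 2` is the tree's
  `GaloisRepresentations.finrank_eq_two_of_isCyclotomicExtension_three`), a model of `ℚ(ζ₃)`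
  exists, and the HEADLINES
  **`chiBranchLeadingTermOddAt_three : thm16_minus… → ∀ W, ChiBranchLeadingTermOddAt W 3`** and
  **`chiBranchLeadingTermOddBigImageAt_three : kato_minus…_of_surjective → ∀ W,
  ChiBranchLeadingTermOddBigImageAt W 3`**.

CONSEQUENCE (next file, `RankZeroChiBranchThreeFacts`): every gen-6/7 `p = 3` consumer fires
class-wide — the rank-`0` upper half of `BSD(E,3)` for EVERY X3♯(M) curve and every X4(M) ∧ surj(3)
curve (and, via additive-p2/p4's twins, X3♯(G-ord) / X4♯(G-ord) ∧ surj(3) and every X3/X4 curve with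
a semistable-ordinary twist by `−3`) from published theorems (Delbourgo 1998 Prop. 4, Wuthrich 2014
Thm. 16 / Lemma 20, Kato 2004 Thm. 17.4, GZK, modularity) + kernel glue, and `BSD(E,3)` itself on the
`3 ∤ #Ш_an(E)` rows. Labels UNCHANGED (the LOWER half / SU direction on the `ω`-branch stays printed
nowhere; ranks `≠ 0` untouched); nothing booked.

References: C. Wuthrich, Doc. Math. 19 (2014), §3 p. 390, Thm. 16, Cor. 19 [Wuthrich2014]; K. Kato,
Astérisque 295 (2004), Thm. 17.4 [Kato2004Asterisque]; B. Mazur, J. Tate, J. Teitelbaum, Invent.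
Math. 84 (1986), §I.10, §I.13–I.14 [MazurTateTeitelbaum1986Invent]; R. Greenberg, LNM 1716 (1999),
§5 p. 143 [GreenbergLNM1716].
-/

noncomputable section

open scoped Classical MatrixGroups ModularForm

namespace Summit.BirchSwinnertonDyer.Rank1Residual.AdditivePotMult

open CongruenceSubgroup WeierstrassCurve Literature.NumberTheory.EllipticCurves
  Literature.NumberTheory.EllipticCurves.ModularForms
  Literature.NumberTheory.EllipticCurves.Rank1Residual Literature.NumberTheory.GaloisRepresentations
  Additive Polynomial

/-! ## §1 The `χ_K`-eigen dual datum IS a Literature eigen-dual datum -/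

section ToEigen

variable (V : WeierstrassCurve ℚ) (K : Type) [Field K] [NumberField K] {p : ℕ} [Fact p.Prime]
  (κ : ZpExtension ℚ p) [(galRange (K := ℚ) K).Normal] (γ : Field.absoluteGaloisGroup ℚ)

/-- `chiEigenSelmer V K p κ` IS, on the nose, the Literature eigen-Selmer group
`eigenSelmerGroupOver` (file `IwasawaSelmerEigen`) at `H = ker κ ⊓ Gal(ℚ̄/K)`, `H' = ker κ`,
`ε = χ_K` (`+1` on `Gal(ℚ̄/K)`, `−1` off it). [folklore] -/
theorem chiEigenSelmer_eq_eigenSelmerGroupOver :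
    chiEigenSelmer V K p κ =
      V.eigenSelmerGroupOver p (κ.kerSubgroup ⊓ galRange (K := ℚ) K) κ.kerSubgroup
        (fun g ↦ if g ∈ galRange (K := ℚ) K then 1 else -1) :=
  rfl

/-- **A `ChiEigenSelmerDualData V K κ γ` IS a Literature `EigenSelmerDualData`** for
`(H, H', ε) = (ker κ ⊓ Gal(ℚ̄/K), ker κ, χ_K)` with the SAME underlying `Λ`-module (the `γ`-stability
field is the proved `conjH1_mem_chiEigenSelmer`). [folklore] -/
def ChiEigenSelmerDualData.toEigen (D : ChiEigenSelmerDualData V K κ γ) :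
    V.EigenSelmerDualData p (κ.kerSubgroup ⊓ galRange (K := ℚ) K) κ.kerSubgroup
      (fun g ↦ if g ∈ galRange (K := ℚ) K then 1 else -1) γ where
  X := D.X
  conj_mem := fun _ ht ↦ conjH1_mem_chiEigenSelmer V K κ γ ht
  toDual := D.toDual
  bijective := D.bijective
  toDual_T_smul := D.toDual_T_smul
  toDual_C_smul := D.toDual_C_smul

/-- Same module. [folklore] -/
theorem ChiEigenSelmerDualData.toEigen_X (D : ChiEigenSelmerDualData V K κ γ) :
    (ChiEigenSelmerDualData.toEigen V K κ γ D).X = D.X :=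
  rfl

/-- Same characteristic ideal. [folklore] -/
theorem ChiEigenSelmerDualData.charIdeal_toEigen (D : ChiEigenSelmerDualData V K κ γ) :
    (ChiEigenSelmerDualData.toEigen V K κ γ D).charIdeal =
      Literature.NumberTheory.EllipticCurves.Module.charIdeal (IwasawaAlgebra p) D.X :=
  rfl

end ToEigen

/-! ## §2 The odd branch of a `3`-semistable curve and its constant term -/

section OddBranch

/-- **The odd branch at `p = 3` and its value at `T = 0`.** For `V` globally minimal, good
ordinary or multiplicative at `3`, with newform `f`: there is a power series `L⁻` which is THE odd
branch of the matching MTT measure — `padicLFunctionMinusBranch f α 1` (`α = unitRoot V 3`, good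
ordinary) / `padicLFunctionMinusBranchMult f 1 1` (split) / `padicLFunctionMinusBranchMult f (−1) 1`
(non-split) — in the exact disjunctive shape of the brick-4 facts, together with a `3`-adic unit `e`
(`α⁻¹`, `1`, `−1`) such that `L⁻(0) = e · ∑_{a mod 3} (a/3)[a/3]⁻_f` (tree theorems
`constantCoeff_padicLFunctionMinusBranch_one_three`,
`constantCoeff_padicLFunctionMinusBranchMult_one_three_of_[non]split`; MTT §I.13–I.14).
[cite: MazurTateTeitelbaum1986Invent, §I.13–I.14] -/
theorem exists_oddBranch_three {V : WeierstrassCurve ℚ} [V.IsElliptic] [V.IsGloballyMinimal]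
    {N : ℕ} [NeZero N] {f : CuspForm (Gamma0 N) 2} (hGM : GoodOrd V 3 ∨ Mult V 3)
    (hf : IsNewformOf V f) :
    ∃ (Lminus : PowerSeries ℚ_[3]) (e : ℤ_[3]ˣ),
      ((IsOrdinaryAt V 3 ∧
          Lminus = padicLFunctionMinusBranch f ((unitRoot V 3 : ℤ_[3]) : ℚ_[3]) 1) ∨
        (V.HasSplitMultiplicativeReductionAtPrime 3 ∧
          Lminus = padicLFunctionMinusBranchMult f (1 : ℚ_[3]) 1) ∨
        (V.HasMultiplicativeReductionAtPrime 3 ∧ ¬ V.HasSplitMultiplicativeReductionAtPrime 3 ∧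
          Lminus = padicLFunctionMinusBranchMult f (-1 : ℚ_[3]) 1)) ∧
      PowerSeries.constantCoeff Lminus =
        ((e : ℤ_[3]) : ℚ_[3]) * (legendreMinusSymbolSum f 3 : ℚ_[3]) := by
  rcases hGM with hgo | hmult
  · have hord : IsOrdinaryAt V 3 := (isOrdinaryAt_iff V 3).mpr hgo
    obtain ⟨-, hunit⟩ := unitRoot_spec_holds V 3 hord
    refine ⟨_, hunit.unit⁻¹, Or.inl ⟨hord, rfl⟩, ?_⟩
    have hcoe : ((hunit.unit : ℤ_[3]) : ℚ_[3]) = ((unitRoot V 3 : ℤ_[3]) : ℚ_[3]) := by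
      rw [IsUnit.unit_spec]
    have hinv :
        (((hunit.unit⁻¹ : ℤ_[3]ˣ) : ℤ_[3]) : ℚ_[3]) = ((unitRoot V 3 : ℤ_[3]) : ℚ_[3])⁻¹ := by
      rw [← hcoe]
      refine eq_inv_of_mul_eq_one_left ?_
      rw [← PadicInt.coe_mul, Units.inv_mul, PadicInt.coe_one]
    rw [constantCoeff_padicLFunctionMinusBranch_one_three V hord hf, hinv]
  · by_cases hs : V.HasSplitMultiplicativeReductionAtPrime 3
    · exact ⟨_, 1, Or.inr (Or.inl ⟨hs, rfl⟩),
        constantCoeff_padicLFunctionMinusBranchMult_one_three_of_split V hs hf⟩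
    · exact ⟨_, -1, Or.inr (Or.inr ⟨hmult, hs, rfl⟩),
        constantCoeff_padicLFunctionMinusBranchMult_one_three_of_nonsplit V hmult hs hf⟩

/-- From `ι g = C(u ϖ') · L⁻` and `L⁻(0) = e · Σ` to `g(0) = (u e) · ϖ' · Σ`. [folklore] -/
theorem exists_unit_constantCoeff_of_eq_C_mul {N : ℕ} {f : CuspForm (Gamma0 N) 2}
    {g : IwasawaAlgebra 3} {u e : ℤ_[3]ˣ} {ϖ : ℚ} {Lminus : PowerSeries ℚ_[3]}
    (hg : iwasawaToPowerSeries 3 g = PowerSeries.C (((u : ℤ_[3]) : ℚ_[3]) * (ϖ : ℚ_[3])) * Lminus)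
    (hL : PowerSeries.constantCoeff Lminus =
      ((e : ℤ_[3]) : ℚ_[3]) * (legendreMinusSymbolSum f 3 : ℚ_[3])) :
    ∃ u' : ℤ_[3]ˣ, ((PowerSeries.constantCoeff g : ℤ_[3]) : ℚ_[3]) =
      ((u' : ℤ_[3]) : ℚ_[3]) * (ϖ : ℚ_[3]) * (legendreMinusSymbolSum f 3 : ℚ_[3]) := by
  refine ⟨u * e, ?_⟩
  have h0 := congrArg PowerSeries.constantCoeff hg
  rw [map_mul, PowerSeries.constantCoeff_C, hL, constantCoeff_iwasawaToPowerSeries] at h0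
  rw [h0, Units.val_mul, PadicInt.coe_mul]
  ring

end OddBranch

/-! ## §3 `EigenLeadingTermOddAt V K 3` from brick 4 (reducible) -/

section Reducible

variable (K : Type) [Field K] [NumberField K] [IsCyclotomicExtension {3} ℚ K]
  [(galRange (K := ℚ) K).Normal]

/-- **[B]⁻@0 at `p = 3` DISCHARGED from the componentwise Wuthrich reading.** For `K = ℚ(ζ₃)`
and every `V/ℚ`: `EigenLeadingTermOddAt V K 3` (file `EigenLeadingTermInput`) follows from the
named fact `Wuthrich2014.thm16_minusEigenCharIdeal_dvd_cyclotomicThree` — apply it to the eigen-datum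
`D.toEigen` (same module) with the odd branch of `exists_oddBranch_three`, and read the constant
term (`exists_unit_constantCoeff_of_eq_C_mul`). [folklore] -/
theorem eigenLeadingTermOddAt_three_of_fact
    (hW : Wuthrich2014.thm16_minusEigenCharIdeal_dvd_cyclotomicThree) (V : WeierstrassCurve ℚ) :
    EigenLeadingTermOddAt V K 3 := by
  intro _ _ κ γ N _ f _ hGM hred hκ hγ hcyc hγK hf D ϖ hϖ
  obtain ⟨Lminus, e, hdisj, hL0⟩ := exists_oddBranch_three hGM hf
  obtain ⟨htor, g, hg, u, hu⟩ := hW V K Lminus hdisj hred hκ hγ hcyc hγK hf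
    (ChiEigenSelmerDualData.toEigen V K κ γ D) ϖ hϖ
  exact ⟨htor, g, hg, exists_unit_constantCoeff_of_eq_C_mul hu hL0⟩

end Reducible

/-! ## §4 The big-image twin: typed input and its discharge -/

/-- **[B]⁻@0, big image, TYPED** — the `χ_K`-COMPONENT form of additive-p4's
`ChiBranchLeadingTermOddBigImageAt` stated for the `p`-SEMISTABLE curve `V` alone: as
`EigenLeadingTermOddAt` with "`V[p]` reducible" replaced by "`ρ̄_{V,p^n}` onto for every `n`".
A predicate on `(V, K, p)`; NOTHING is asserted (at `p = 3`, `K = ℚ(ζ₃)` it is discharged below from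
the named fact `Wuthrich2014.kato_minusEigenCharIdeal_dvd_cyclotomicThree_of_surjective`).
[cite: Kato2004Asterisque, Thm. 17.4 (3) (p. 273) (shape only; nothing asserted)]
[cite: Wuthrich2014, Thm. 3 (p. 383) and Cor. 19 (p. 398) (shape only; nothing asserted)] -/
def EigenLeadingTermOddBigImageAt (V : WeierstrassCurve ℚ) (K : Type) [Field K] [NumberField K]
    [(galRange (K := ℚ) K).Normal] (p : ℕ) [Fact p.Prime] : Prop :=
  ∀ [V.IsElliptic] [V.IsGloballyMinimal] {κ : ZpExtension ℚ p} {γ : Field.absoluteGaloisGroup ℚ}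
    {N : ℕ} [NeZero N] {f : CuspForm (Gamma0 N) 2},
    p % 4 = 3 → (GoodOrd V p ∨ Mult V p) → (∀ n : ℕ, V.HasSurjectiveModNGaloisRep (p ^ n : ℕ)) →
    κ.IsCyclotomic → κ.IsTopGenerator γ → IsCyclotomicVariable p γ →
    γ ∈ galRange (K := ℚ) K → IsNewformOf V f →
    ∀ (D : ChiEigenSelmerDualData V K κ γ) (ϖ : ℚ), (ϖ : ℝ) * V.imaginaryPeriodRat = minusPeriod f →
      Module.IsTorsion (IwasawaAlgebra p) D.X ∧
      ∃ g ∈ Literature.NumberTheory.EllipticCurves.Module.charIdeal (IwasawaAlgebra p) D.X,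
        ∃ u : ℤ_[p]ˣ,
          ((PowerSeries.constantCoeff g : ℤ_[p]) : ℚ_[p]) =
            ((u : ℤ_[p]) : ℚ_[p]) * (ϖ : ℚ_[p]) * (legendreMinusSymbolSum f p : ℚ_[p])

/-- **`ChiBranchLeadingTermOddBigImageAt W p` FROM the twist-free componentwise big-image input**
(the big-image twin of `chiBranchLeadingTermOddAt_of_eigenLeadingTerm`, same proof without the
reducibility transfer: the image hypothesis of `ChiBranchLeadingTermOddBigImageAt` is already on
`V`). [folklore] -/
theorem chiBranchLeadingTermOddBigImageAt_of_eigenLeadingTermBigImage (W : WeierstrassCurve ℚ)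
    (p : ℕ) [Fact p.Prime] (K : Type) [Field K] [NumberField K] [(galRange (K := ℚ) K).Normal]
    (h2 : Module.finrank ℚ K = 2) {θ : K} (hθ : θ ∉ Set.range (algebraMap ℚ K))
    (hc : θ ^ 2 = algebraMap ℚ K (-(p : ℚ)))
    (h : ∀ (V : WeierstrassCurve ℚ) [V.IsElliptic] [V.IsGloballyMinimal],
      (∃ C : VariableChange ℚ, C • V.quadraticTwist (-(p : ℚ)) = W) →
        EigenLeadingTermOddBigImageAt V K p) :
    ChiBranchLeadingTermOddBigImageAt W p := by
  intro V _ _ κ γ N _ f hp4 hCW hVp hsurj hκ hγ hcyc hf D ϖ hϖ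
  obtain ⟨C, hCW'⟩ := hCW
  have hp2 : p ≠ 2 := by rintro rfl; norm_num at hp4
  have hpQ : (-(p : ℚ)) ≠ 0 := neg_ne_zero.mpr (Nat.cast_ne_zero.mpr (Fact.out : p.Prime).ne_zero)
  haveI : (V.quadraticTwist (-(p : ℚ))).IsElliptic := isElliptic_quadraticTwist V hpQ
  haveI : W.IsElliptic := by rw [← hCW']; infer_instance
  obtain ⟨g₀, hg₀, hγ'U, hconj, -⟩ := exists_mul_mem_galRange W K h2 hθ hc κ hp2 γ
  have hγ' : κ.IsTopGenerator (γ * g₀) := isTopGenerator_mul_of_mem_kerSubgroup κ hγ hg₀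
  have hcyc' : IsCyclotomicVariable p (γ * g₀) := isCyclotomicVariable_mul hκ hcyc hg₀
  let D' : W.SelmerDualData κ (γ * g₀) := SelmerDualData.congrGen W κ hconj D
  let Dχ : ChiEigenSelmerDualData V K κ (γ * g₀) :=
    SelmerDualData.toChiEigen V K h2 hθ hc p κ hCW' hγ'U hp2 D'
  obtain ⟨htor, g, hg, u, hu⟩ := h V ⟨C, hCW'⟩ hp4 hVp hsurj hκ hγ' hcyc' hγ'U hf Dχ ϖ hϖ
  exact ⟨htor, g, hg, u, hu⟩

section BigImage

variable (K : Type) [Field K] [NumberField K] [IsCyclotomicExtension {3} ℚ K]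
  [(galRange (K := ℚ) K).Normal]

/-- **[B]⁻@0 at `p = 3`, big image, DISCHARGED** from the componentwise Kato / Wuthrich-Cor-19
reading `Wuthrich2014.kato_minusEigenCharIdeal_dvd_cyclotomicThree_of_surjective`. [folklore] -/
theorem eigenLeadingTermOddBigImageAt_three_of_fact
    (hK : Wuthrich2014.kato_minusEigenCharIdeal_dvd_cyclotomicThree_of_surjective)
    (V : WeierstrassCurve ℚ) : EigenLeadingTermOddBigImageAt V K 3 := by
  intro _ _ κ γ N _ f _ hGM hsurj hκ hγ hcyc hγK hf D ϖ hϖ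
  obtain ⟨Lminus, e, hdisj, hL0⟩ := exists_oddBranch_three hGM hf
  obtain ⟨htor, g, hg, u, hu⟩ := hK V K Lminus hdisj hsurj hκ hγ hcyc hγK hf
    (ChiEigenSelmerDualData.toEigen V K κ γ D) ϖ hϖ
  exact ⟨htor, g, hg, exists_unit_constantCoeff_of_eq_C_mul hu hL0⟩

end BigImage

/-! ## §5 The field `ℚ(ζ₃) = ℚ(√−3)` and the class-wide conclusions -/

section Field

variable (K : Type) [Field K] [NumberField K] [IsCyclotomicExtension {3} ℚ K]

/-- `√−3 = 2ζ₃ + 1 ∈ ℚ(ζ₃)`, not rational. [folklore] -/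
theorem exists_sq_eq_neg_three_of_isCyclotomicExtension_three :
    ∃ θ : K, θ ∉ Set.range (algebraMap ℚ K) ∧ θ ^ 2 = algebraMap ℚ K (-(3 : ℕ) : ℚ) := by
  set ζ : K := IsCyclotomicExtension.zeta 3 ℚ K with hζ
  have hprim : IsPrimitiveRoot ζ 3 := IsCyclotomicExtension.zeta_spec 3 ℚ K
  have hsum : 1 + ζ + ζ ^ 2 = 0 := by
    have h := hprim.geom_sum_eq_zero (by norm_num : 1 < 3)
    simpa [Finset.sum_range_succ, add_assoc] using h
  have hθ2 : (2 * ζ + 1) ^ 2 = algebraMap ℚ K (-(3 : ℕ) : ℚ) := by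
    have : (2 * ζ + 1) ^ 2 = 4 * (1 + ζ + ζ ^ 2) - 3 := by ring
    rw [this, hsum, mul_zero, zero_sub]
    simp
  refine ⟨2 * ζ + 1, ?_, hθ2⟩
  rintro ⟨q, hq⟩
  have hsq : algebraMap ℚ K (q ^ 2) = algebraMap ℚ K (-(3 : ℕ) : ℚ) := by rw [map_pow, hq, hθ2]
  have hq2 : q ^ 2 = (-(3 : ℕ) : ℚ) := (algebraMap ℚ K).injective hsq
  push_cast at hq2
  nlinarith [sq_nonneg q]

/-- A number field `K = ℚ(ζ₃)` exists (e.g. `CyclotomicField 3 ℚ`). [folklore] -/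
theorem exists_isCyclotomicExtension_three :
    ∃ (K : Type) (_ : Field K) (_ : NumberField K), IsCyclotomicExtension {3} ℚ K :=
  haveI : NeZero ((3 : ℕ) : ℚ) := ⟨by norm_num⟩
  ⟨CyclotomicField 3 ℚ, inferInstance, inferInstance, CyclotomicField.isCyclotomicExtension 3 ℚ⟩

end Field

section Conclusions

/-- **`ChiBranchLeadingTermOddAt W 3` for EVERY `W/ℚ`** (additive-p4's typed input [B∘C]@0 at
`p = 3`, reducible twist), from the named fact
`Wuthrich2014.thm16_minusEigenCharIdeal_dvd_cyclotomicThree` + kernel bricks 1–3, 5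
(`chiBranchLeadingTermOddAt_of_eigenLeadingTerm`). [folklore] -/
theorem chiBranchLeadingTermOddAt_three_of_fact (K : Type) [Field K] [NumberField K]
    [IsCyclotomicExtension {3} ℚ K] [(galRange (K := ℚ) K).Normal]
    (hW : Wuthrich2014.thm16_minusEigenCharIdeal_dvd_cyclotomicThree)
    (W : WeierstrassCurve ℚ) : ChiBranchLeadingTermOddAt W 3 := by
  obtain ⟨θ, hθ, hc⟩ := exists_sq_eq_neg_three_of_isCyclotomicExtension_three K
  exact chiBranchLeadingTermOddAt_of_eigenLeadingTerm W 3 K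
    (Literature.NumberTheory.GaloisRepresentations.finrank_eq_two_of_isCyclotomicExtension_three
      (K := K)) hθ hc
    (fun V _ _ _ ↦ eigenLeadingTermOddAt_three_of_fact K hW V)

/-- **`ChiBranchLeadingTermOddBigImageAt W 3` for EVERY `W/ℚ`** (the big-image typed input at
`p = 3`), from `Wuthrich2014.kato_minusEigenCharIdeal_dvd_cyclotomicThree_of_surjective` + kernel
bricks. [folklore] -/
theorem chiBranchLeadingTermOddBigImageAt_three_of_fact (K : Type) [Field K] [NumberField K]
    [IsCyclotomicExtension {3} ℚ K] [(galRange (K := ℚ) K).Normal]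
    (hK : Wuthrich2014.kato_minusEigenCharIdeal_dvd_cyclotomicThree_of_surjective)
    (W : WeierstrassCurve ℚ) : ChiBranchLeadingTermOddBigImageAt W 3 := by
  obtain ⟨θ, hθ, hc⟩ := exists_sq_eq_neg_three_of_isCyclotomicExtension_three K
  exact chiBranchLeadingTermOddBigImageAt_of_eigenLeadingTermBigImage W 3 K
    (Literature.NumberTheory.GaloisRepresentations.finrank_eq_two_of_isCyclotomicExtension_three
      (K := K)) hθ hc
    (fun V _ _ _ ↦ eigenLeadingTermOddBigImageAt_three_of_fact K hK V)

end Conclusions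

/-! ## §6 `K`-free statements via `K = CyclotomicField 3 ℚ` -/

section KFree

/-- **Headline (reducible): `ChiBranchLeadingTermOddAt W 3` for every `W/ℚ`**, granted the one
named fact (the field `ℚ(ζ₃)` is chosen inside the proof; `galRange` of a Galois number field is
normal, `RelModel.normal_galRange`). [folklore] -/
theorem chiBranchLeadingTermOddAt_three
    (hW : Wuthrich2014.thm16_minusEigenCharIdeal_dvd_cyclotomicThree) (W : WeierstrassCurve ℚ) :
    ChiBranchLeadingTermOddAt W 3 := by
  obtain ⟨K, _, _, _⟩ := exists_isCyclotomicExtension_three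
  haveI : IsGalois ℚ K := IsCyclotomicExtension.isGalois {3} ℚ K
  haveI : (galRange (K := ℚ) K).Normal := RelModel.normal_galRange (K := ℚ) K
  exact chiBranchLeadingTermOddAt_three_of_fact K hW W

/-- **Headline (big image): `ChiBranchLeadingTermOddBigImageAt W 3` for every `W/ℚ`**, granted
the one named fact. [folklore] -/
theorem chiBranchLeadingTermOddBigImageAt_three
    (hK : Wuthrich2014.kato_minusEigenCharIdeal_dvd_cyclotomicThree_of_surjective)
    (W : WeierstrassCurve ℚ) : ChiBranchLeadingTermOddBigImageAt W 3 := by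
  obtain ⟨K, _, _, _⟩ := exists_isCyclotomicExtension_three
  haveI : IsGalois ℚ K := IsCyclotomicExtension.isGalois {3} ℚ K
  haveI : (galRange (K := ℚ) K).Normal := RelModel.normal_galRange (K := ℚ) K
  exact chiBranchLeadingTermOddBigImageAt_three_of_fact K hK W

end KFree

end Summit.BirchSwinnertonDyer.Rank1Residual.AdditivePotMult

end
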